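import Mathlib
import HarnessLib
import Summits.Ventures.LatticeQCDFlow.Exactness.SUNLeapfrogHMCWalk
import Summits.Ventures.LatticeQCDFlow.Exactness.MetropolisSweepConvergence

/-!
# Single-step leapfrog HMC on `SU(N)` lattice gauge fields is uniformly ergodic (a power of the kernel is Doeblin)

HONEST FRAMING: exact (Metropolis-corrected) sampling algorithms for lattice gauge theory;
figures of merit are autocorrelation/cost numbers at stated couplings and volumes; no
continuum-physics claim.

Venture `LatticeQCDFlow` (cell pub-lqcd), topic `Exactness`, FANOUT row 9 (eng-latcore, the
engine `latflow.core.hmc.HMC(f, β, 'leapfrog')` / `sun_2d.HMC2D` on `SU(N)`, `trajectory(τ, nstep = 1)`).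
NEW WORK of the cell over the tree (`SUNLeapfrogHMCWalk.lean`: one step dominates `δ₁ · (⊗ chartKick)·U`;
`SUNExpChartMinorisation.sunKick_nHit_minorised`: the chart kick covers on one link;
`PiGroupKicks.lean` / `MetropolisSweepErgodic.lean`: `smul_nHit_le_nHit`, `nHit_mulWalk`,
`mconvPow_pi_succ`, `smul_haar_le_mconvPow`; `MetropolisSweepConvergence.uniformlyErgodic_of_nHit_minorised`;
`DoeblinUniqueness.invariant_unique_of_minorised`); nothing here is cited as a fact.  Printed
counterparts, named only: Duane–Kennedy–Pendleton–Roweth 1987; Meyn–Tweedie ch. 16.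

* **`sunLeapfrogHMC_nHit_minorised`** — for `ι` injective onto `𝔰𝔲(N)` (`N ≥ 1`), `ε > 0`, a
  measurable kinetic term `T ≥ 0` bounded on boxes with `Z_T < ∞`, a measurable force increment bounded
  by `b ≥ 0`, a measurable action bounded by `s`: some power `K^{k+1}` dominates `δ · Haar^{⊗links}`
  from every start (per-link covering, products, right invariance of product Haar).
* **`sunLeapfrogHMC_uniformlyErgodic`** — `|μ₀Kᵗ(A) − π_S(A)| ≤ (1 − δ)^{⌊t/(k+1)⌋}` for EVERY initial
  law, `π_S = gibbsProbability Haar^{⊗links} e^{−S}` (`= Z_S⁻¹e^{−S}·Haar^⊗`);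
  **`sunLeapfrogHMC_invariant_unique`** — `π_S` is the ONLY invariant probability law.  The `SU(3)` HMC
  row of the exactness table at `nstep = 1`, typed.

NOT CLAIMED: `nstep ≥ 2` / OMF / `tau_jitter` (fixed-length multi-step trajectories can be
non-ergodic, Mackenzie 1989); any usable constant (`k`, `δ` come from the inverse function theorem
and compactness); floating point; the dictionary between the engine's Gaussian `random_algebra`
momenta and `Z⁻¹e^{−T}μ^⊗` in a particular coordinate system (`SUNLeapfrogHMCEngine.lean`).
-/

noncomputable section

namespace Summit.Ventures.LatticeQCDFlow.Exactness

open MeasureTheory ProbabilityTheory ProbabilityTheory.Kernel Set Metric Function NormedSpace Filter Topology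
open Literature.MathematicalPhysics.QuantumFieldTheory (haarProbability)
open scoped ENNReal Matrix NNReal

section SUN

variable {n : Type*} [Fintype n] [DecidableEq n]
variable {E : Type*} [NormedAddCommGroup E] [NormedSpace ℝ E] [MeasurableSpace E] [BorelSpace E]
  [FiniteDimensional ℝ E]
variable (ι : E →ₗ[ℝ] Matrix n n ℂ) (hι : ∀ a, (ι a)ᴴ = -ι a ∧ (ι a).trace = 0)
variable {L : Type*} [Fintype L] (μ : Measure E) [μ.IsAddHaarMeasure]
variable {T : (L → E) → ℝ} {τ : ℝ → ℝ} {g : (L → Matrix.specialUnitaryGroup n ℂ) → L → E}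

/-! ## §4 A power of the kernel is Doeblin: uniform ergodicity and uniqueness -/

/-- **A POWER OF SINGLE-STEP LEAPFROG HMC ON `SU(N)^links` IS DOEBLIN** (`ι` injective onto `𝔰𝔲(N)`,
`N ≥ 1`): there are `k` and `δ > 0` with `K^{k+1}(U, ·) ≥ δ · Haar^{⊗links}` from EVERY `U`. -/
theorem sunLeapfrogHMC_nHit_minorised [Nonempty n] (hinj : Injective ι)
    (hsurj : ∀ X : Matrix n n ℂ, Xᴴ = -X → X.trace = 0 → X ∈ LinearMap.range ι)
    {ε : ℝ} (hε : 0 < ε) (hT : Measurable T) (hT0 : ∀ p, 0 ≤ T p)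
    (hTle : ∀ (R : ℝ) (p : L → E), (∀ l, ‖p l‖ ≤ R) → T p ≤ τ R) (hZ : sunMomentumWeight (L := L) μ T univ ≠ ⊤)
    (hg : Measurable g) {b : ℝ} (hb0 : 0 ≤ b) (hb : ∀ u l, ‖g u l‖ ≤ b)
    {S : (L → Matrix.specialUnitaryGroup n ℂ) → ℝ} (hS : Measurable S) {s : ℝ} (hs : ∀ u, |S u| ≤ s) :
    ∃ k : ℕ, ∃ δ : ℝ≥0∞, 0 < δ ∧ ∀ u,
      δ • Measure.pi (fun _ : L => haarProbability (Matrix.specialUnitaryGroup n ℂ)) ≤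
        nHit (sunLeapfrogHMC ι hι μ T ε hg S) (k + 1) u := by
  classical
  obtain ⟨δ₁, hδ₁, hwalk⟩ := sunLeapfrogHMC_minorised_walk ι hι μ (τ := τ) hε hT hT0 hTle hZ hg hb0 hb hS hs
  -- the chart kick covers on one link
  have hcb : (μ (ball (0 : E) 1))⁻¹ ≠ 0 := ENNReal.inv_ne_zero.2 measure_ball_lt_top.ne
  obtain ⟨k, δ', hδ', hcov⟩ := sunKick_nHit_minorised ι hι hinj hsurj μ (ball_mem_nhds (0 : E) one_pos)
    (ν := chartKick ι hι μ) hcb le_rfl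
  refine ⟨k, δ₁ ^ (k + 1) * δ' ^ Fintype.card L, ENNReal.mul_pos (pow_ne_zero _ hδ₁.ne') (pow_ne_zero _ hδ'.ne'),
    fun u => ?_⟩
  -- `K^{k+1} ≥ δ₁^{k+1} • ((⊗ chartKick)^{∗(k+1)})·u`
  have hpow := smul_nHit_le_nHit hwalk (k + 1) u
  rw [nHit_mulWalk, mconvPow_pi_succ] at hpow
  -- each coordinate dominates `δ' ·` Haar, the product `δ'^{|L|} ·` product Haar, translated by `u`
  have hcoord : δ' • haarProbability (Matrix.specialUnitaryGroup n ℂ) ≤ mconvPow (chartKick ι hι μ) (k + 1) :=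
    smul_haar_le_mconvPow hcov (Nat.le_succ k)
  have hpi : δ' ^ Fintype.card L • Measure.pi (fun _ : L => haarProbability (Matrix.specialUnitaryGroup n ℂ)) ≤
      Measure.pi fun _ : L => mconvPow (chartKick ι hι μ) (k + 1) := by
    have h := smul_pi_le_pi (c := fun _ : L => δ') fun _ : L => hcoord
    rwa [Finset.prod_const, Finset.card_univ] at h
  have hmul : δ' ^ Fintype.card L • Measure.pi (fun _ : L => haarProbability (Matrix.specialUnitaryGroup n ℂ)) ≤
      mulWalk (Measure.pi fun _ : L => mconvPow (chartKick ι hι μ) (k + 1)) u := by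
    rw [mulWalk_apply]
    have h := Measure.map_mono hpi (measurable_mul_const u)
    rwa [Measure.map_smul, map_mul_right_eq_self] at h
  calc (δ₁ ^ (k + 1) * δ' ^ Fintype.card L) • Measure.pi (fun _ : L => haarProbability (Matrix.specialUnitaryGroup n ℂ))
      = δ₁ ^ (k + 1) • (δ' ^ Fintype.card L • Measure.pi (fun _ : L => haarProbability (Matrix.specialUnitaryGroup n ℂ))) := by
        rw [mul_smul]
    _ ≤ δ₁ ^ (k + 1) • mulWalk (Measure.pi fun _ : L => mconvPow (chartKick ι hι μ) (k + 1)) u :=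
        measure_smul_le_smul_of_le hmul _
    _ ≤ nHit (sunLeapfrogHMC ι hι μ T ε hg S) (k + 1) u := hpow

omit [Fintype L] in
/-- The Gibbs weight `e^{−S}` of an action bounded by `s` is pinched between `e^{−s}` and `e^{s}`. -/
theorem gibbsWeight_pinched {S : (L → Matrix.specialUnitaryGroup n ℂ) → ℝ} {s : ℝ} (hs : ∀ u, |S u| ≤ s) :
    (∀ u, Real.exp (-s) ≤ Real.exp (-S u)) ∧ ∀ u, Real.exp (-S u) ≤ Real.exp s :=
  ⟨fun u => Real.exp_le_exp.2 (by linarith [(abs_le.1 (hs u)).2]),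
    fun u => Real.exp_le_exp.2 (by linarith [(abs_le.1 (hs u)).1])⟩

/-- **SINGLE-STEP LEAPFROG HMC ON `SU(N)^links` IS UNIFORMLY ERGODIC.**  Coordinates `ι` injective onto
`𝔰𝔲(N)` (`N ≥ 1`); step size `ε > 0`; measurable kinetic term `T ≥ 0` bounded on boxes with `Z_T < ∞`;
measurable force increment bounded by `b ≥ 0`; measurable action bounded by `s`.  Then there are `k` and
`δ ∈ (0, 1]` with `|μ₀Kᵗ(A) − π_S(A)| ≤ (1 − δ)^{⌊t/(k+1)⌋}` for EVERY initial law `μ₀`, every `t`, every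
`A`, where `π_S = gibbsProbability Haar^{⊗links} e^{−S}` (`= Z_S⁻¹e^{−S}·Haar^⊗`). -/
theorem sunLeapfrogHMC_uniformlyErgodic [Nonempty n] (hinj : Injective ι)
    (hsurj : ∀ X : Matrix n n ℂ, Xᴴ = -X → X.trace = 0 → X ∈ LinearMap.range ι)
    {ε : ℝ} (hε : 0 < ε) (hT : Measurable T) (hT0 : ∀ p, 0 ≤ T p)
    (hTle : ∀ (R : ℝ) (p : L → E), (∀ l, ‖p l‖ ≤ R) → T p ≤ τ R) (hZ : sunMomentumWeight (L := L) μ T univ ≠ ⊤)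
    (hg : Measurable g) {b : ℝ} (hb0 : 0 ≤ b) (hb : ∀ u l, ‖g u l‖ ≤ b)
    {S : (L → Matrix.specialUnitaryGroup n ℂ) → ℝ} (hS : Measurable S) {s : ℝ} (hs : ∀ u, |S u| ≤ s) :
    ∃ k : ℕ, ∃ δ : ℝ, 0 < δ ∧ δ ≤ 1 ∧ ∀ (μ₀ : Measure (L → Matrix.specialUnitaryGroup n ℂ))
      [IsProbabilityMeasure μ₀] (t : ℕ) (A : Set (L → Matrix.specialUnitaryGroup n ℂ)),
      |((fun m : Measure (L → Matrix.specialUnitaryGroup n ℂ) => m.bind (sunLeapfrogHMC ι hι μ T ε hg S))^[t] μ₀).real A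
          - (gibbsProbability (Measure.pi fun _ : L => haarProbability (Matrix.specialUnitaryGroup n ℂ))
              (fun u => Real.exp (-S u))).real A| ≤ (1 - δ) ^ (t / (k + 1)) := by
  obtain ⟨hlo, hhi⟩ := gibbsWeight_pinched (L := L) (n := n) hs
  haveI := isProbabilityMeasure_gibbsProbability
    (μ := Measure.pi fun _ : L => haarProbability (Matrix.specialUnitaryGroup n ℂ)) (Real.exp_pos (-s)) hlo hhi
  haveI := isProbabilityMeasure_sunMomentumLaw (L := L) μ T hT hZ
  have hH : Measurable fun z : (L → Matrix.specialUnitaryGroup n ℂ) × (L → E) => S z.1 + T z.2 :=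
    (hS.comp measurable_fst).add (hT.comp measurable_snd)
  haveI : Fact (Measurable fun z : (L → Matrix.specialUnitaryGroup n ℂ) × (L → E) => S z.1 + T z.2) := ⟨hH⟩
  haveI : IsMarkovKernel (sunLeapfrogHMC ι hι μ T ε hg S) := by unfold sunLeapfrogHMC; infer_instance
  obtain ⟨k, δ, hδ0, hmin⟩ := sunLeapfrogHMC_nHit_minorised ι hι μ (τ := τ) hinj hsurj hε hT hT0 hTle hZ hg hb0 hb hS hs
  haveI : IsMarkovKernel (nHit (sunLeapfrogHMC ι hι μ T ε hg S) (k + 1)) := isMarkovKernel_nHit _ _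
  have hδ1 : δ ≤ 1 := by
    have h := Measure.le_iff'.1 (hmin fun _ => 1) univ
    rwa [Measure.smul_apply, smul_eq_mul, measure_univ, measure_univ, mul_one] at h
  have hδtop : δ ≠ ⊤ := ne_top_of_le_ne_top ENNReal.one_ne_top hδ1
  refine ⟨k, δ.toReal, ENNReal.toReal_pos hδ0.ne' hδtop,
    ENNReal.toReal_le_of_le_ofReal zero_le_one (by rwa [ENNReal.ofReal_one]), fun μ₀ _ t A => ?_⟩
  exact uniformlyErgodic_of_nHit_minorised hmin (sunLeapfrogHMC_invariant_gibbs ι hι hg hT hZ hS) μ₀ t A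

/-- **The Gibbs law is the unique invariant probability law** of single-step leapfrog HMC on
`SU(N)^links` (same hypotheses). -/
theorem sunLeapfrogHMC_invariant_unique [Nonempty n] (hinj : Injective ι)
    (hsurj : ∀ X : Matrix n n ℂ, Xᴴ = -X → X.trace = 0 → X ∈ LinearMap.range ι)
    {ε : ℝ} (hε : 0 < ε) (hT : Measurable T) (hT0 : ∀ p, 0 ≤ T p)
    (hTle : ∀ (R : ℝ) (p : L → E), (∀ l, ‖p l‖ ≤ R) → T p ≤ τ R) (hZ : sunMomentumWeight (L := L) μ T univ ≠ ⊤)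
    (hg : Measurable g) {b : ℝ} (hb0 : 0 ≤ b) (hb : ∀ u l, ‖g u l‖ ≤ b)
    {S : (L → Matrix.specialUnitaryGroup n ℂ) → ℝ} (hS : Measurable S) {s : ℝ} (hs : ∀ u, |S u| ≤ s)
    {π' : Measure (L → Matrix.specialUnitaryGroup n ℂ)} [IsProbabilityMeasure π']
    (hπ' : Invariant (sunLeapfrogHMC ι hι μ T ε hg S) π') :
    π' = gibbsProbability (Measure.pi fun _ : L => haarProbability (Matrix.specialUnitaryGroup n ℂ))
      (fun u => Real.exp (-S u)) := by
  obtain ⟨hlo, hhi⟩ := gibbsWeight_pinched (L := L) (n := n) hs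
  haveI := isProbabilityMeasure_gibbsProbability
    (μ := Measure.pi fun _ : L => haarProbability (Matrix.specialUnitaryGroup n ℂ)) (Real.exp_pos (-s)) hlo hhi
  haveI := isProbabilityMeasure_sunMomentumLaw (L := L) μ T hT hZ
  have hH : Measurable fun z : (L → Matrix.specialUnitaryGroup n ℂ) × (L → E) => S z.1 + T z.2 :=
    (hS.comp measurable_fst).add (hT.comp measurable_snd)
  haveI : Fact (Measurable fun z : (L → Matrix.specialUnitaryGroup n ℂ) × (L → E) => S z.1 + T z.2) := ⟨hH⟩
  haveI : IsMarkovKernel (sunLeapfrogHMC ι hι μ T ε hg S) := by unfold sunLeapfrogHMC; infer_instance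
  obtain ⟨k, δ, hδ0, hmin⟩ := sunLeapfrogHMC_nHit_minorised ι hι μ (τ := τ) hinj hsurj hε hT hT0 hTle hZ hg hb0 hb hS hs
  haveI : IsMarkovKernel (nHit (sunLeapfrogHMC ι hι μ T ε hg S) (k + 1)) := isMarkovKernel_nHit _ _
  exact invariant_unique_of_minorised hmin hδ0
    (invariant_nHit (sunLeapfrogHMC_invariant_gibbs ι hι hg hT hZ hS) (k + 1)) (invariant_nHit hπ' (k + 1))

end SUN

end Summit.Ventures.LatticeQCDFlow.Exactness
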